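import Summits.FinalStateConjecture.FinalStateConjecture.Theorems.UniformPhotonSphereChannels.Negative.KernelDecay

/-!
# Crux `UniformPhotonSphereChannels` (K1), negative side — the near-horizon decay lemma (II)

Main statement `KernelDecay.eq_zero_of_sq_integrableOn`: if `a'' = V a` on `(−∞, X)` with `V ≥ 0`
continuous and `V(x) ≤ C e^{κx}` there (`κ > 0`), and `∫_{−∞}^{X} a² < ∞`, then `a ≡ 0` on
`(−∞, X)`.  This is the ODE input of the horizon-side kernel census in the Lean refutation of K1
(item stmt-FinalStateConjecture-10045): the top `t`-coefficient of a finite-energy `t`-polynomial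
solution on the near exterior cone is such an `a`, hence vanishes. [folklore]
-/

namespace Summit.FinalStateConjecture.FinalStateConjecture.Theorems

open MeasureTheory Set Filter Topology intervalIntegral

noncomputable section

namespace KernelDecay

variable {V a a' : ℝ → ℝ} {X C κ : ℝ}

/-- FTC for `a'` with `a'' = V a` on `(−∞, X)`: `a'(s) − a'(y) = ∫_y^s V a` for `y ≤ s < X`. -/
theorem deriv_sub_eq_integral (hVc : Continuous V)
    (ha : ∀ x < X, HasDerivAt a (a' x) x) (ha' : ∀ x < X, HasDerivAt a' (V x * a x) x)
    {y s : ℝ} (hys : y ≤ s) (hs : s < X) :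
    a' s - a' y = ∫ u in y..s, V u * a u := by
  have hcont : ContinuousOn (fun u => V u * a u) (uIcc y s) := by
    intro u hu
    rw [uIcc_of_le hys] at hu
    have huX : u < X := lt_of_le_of_lt hu.2 hs
    exact (hVc.continuousAt.mul (ha u huX).continuousAt).continuousWithinAt
  rw [integral_eq_sub_of_hasDerivAt (fun u hu => ha' u ?_) (hcont.intervalIntegrable)]
  rw [uIcc_of_le hys] at hu
  exact lt_of_le_of_lt hu.2 hs

/-- The integral bound: if `0 ≤ a u ≤ a s` for `u ∈ [y, s]`, `V ≥ 0`, `V ≤ C e^{κ·}`, then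
`∫_y^s V a ≤ (C/κ) e^{κ s} · a s`. -/
theorem integral_mul_le (hVc : Continuous V) (hV0 : ∀ x, 0 ≤ V x) (hC : 0 ≤ C) (hκ : 0 < κ)
    (hVexp : ∀ x < X, V x ≤ C * Real.exp (κ * x))
    (ha : ∀ x < X, HasDerivAt a (a' x) x)
    {y s : ℝ} (hys : y ≤ s) (hs : s < X) (hmono : ∀ u ∈ Icc y s, a u ≤ a s) (has : 0 ≤ a s) :
    ∫ u in y..s, V u * a u ≤ C / κ * Real.exp (κ * s) * a s := by
  have hcontV : ContinuousOn (fun u => V u * a u) (Icc y s) := by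
    intro u hu
    have huX : u < X := lt_of_le_of_lt hu.2 hs
    exact (hVc.continuousAt.mul (ha u huX).continuousAt).continuousWithinAt
  have hcontE : Continuous (fun u => C * Real.exp (κ * u) * a s) := by fun_prop
  have h1 : ∫ u in y..s, V u * a u ≤ ∫ u in y..s, C * Real.exp (κ * u) * a s := by
    refine intervalIntegral.integral_mono_on hys
      ((ContinuousOn.intervalIntegrable (by rwa [uIcc_of_le hys]))) (hcontE.intervalIntegrable _ _) ?_
    · intro u hu
      have huX : u < X := lt_of_le_of_lt hu.2 hs
      have h2 : V u * a u ≤ V u * a s := mul_le_mul_of_nonneg_left (hmono u hu) (hV0 u)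
      have h3 : V u * a s ≤ C * Real.exp (κ * u) * a s :=
        mul_le_mul_of_nonneg_right (hVexp u huX) has
      linarith
  have h2 : ∫ u in y..s, C * Real.exp (κ * u) * a s = (∫ u in y..s, C * Real.exp (κ * u)) * a s :=
    intervalIntegral.integral_mul_const _ _
  rw [h2] at h1
  exact h1.trans (mul_le_mul_of_nonneg_right (integral_exp_le hC hκ y s) has)

/-- The positive case.  Under the hypotheses of the decay lemma, `a x > 0` is impossible. -/
theorem not_pos (hκ : 0 < κ) (hC : 0 ≤ C) (hVc : Continuous V) (hV0 : ∀ x, 0 ≤ V x)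
    (hVexp : ∀ x < X, V x ≤ C * Real.exp (κ * x))
    (ha : ∀ x < X, HasDerivAt a (a' x) x) (ha' : ∀ x < X, HasDerivAt a' (V x * a x) x)
    (hint : IntegrableOn (fun x => a x ^ 2) (Iio X)) {x : ℝ} (hx : x < X) : ¬ 0 < a x := by
  intro hax
  have hmono2 := monotoneOn_sq hV0 ha ha' hint
  have hcont : ∀ y < X, ContinuousAt a y := fun y hy => (ha y hy).continuousAt
  -- no sign change without a zero: if `a > 0` at the right end of `[y, x]` and `a ≠ 0` on it
  have hposI : ∀ y ≤ x, (∀ u ∈ Icc y x, a u ≠ 0) → ∀ u ∈ Icc y x, 0 < a u := by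
    intro y hy hne u hu
    by_contra hle
    push Not at hle
    have hcu : ContinuousOn a (Icc u x) := fun v hv =>
      (hcont v (lt_of_le_of_lt hv.2 hx)).continuousWithinAt
    obtain ⟨c, hc, hc0⟩ := intermediate_value_Icc hu.2 hcu ⟨hle, hax.le⟩
    exact hne c ⟨hu.1.trans hc.1, hc.2⟩ hc0
  -- `a'` is non-decreasing on any `[y, x]` on which `a ≥ 0`
  have hderivmono : ∀ D : Set ℝ, Convex ℝ D → D ⊆ Iio X → (∀ u ∈ D, 0 ≤ a u) →
      MonotoneOn a' D := by
    intro D hD hDX hnn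
    refine monotoneOn_of_deriv_nonneg hD
      (fun u hu => (ha' u (hDX hu)).continuousAt.continuousWithinAt)
      (fun u hu => (ha' u (hDX (interior_subset hu))).differentiableAt.differentiableWithinAt) ?_
    intro u hu
    rw [(ha' u (hDX (interior_subset hu))).deriv]
    exact mul_nonneg (hV0 u) (hnn u (interior_subset hu))
  -- `a` is non-decreasing where `a' ≥ 0`
  have hamono : ∀ D : Set ℝ, Convex ℝ D → D ⊆ Iio X → (∀ u ∈ D, 0 ≤ a' u) → MonotoneOn a D := by
    intro D hD hDX hnn
    refine monotoneOn_of_deriv_nonneg hD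
      (fun u hu => (ha u (hDX hu)).continuousAt.continuousWithinAt)
      (fun u hu => (ha u (hDX (interior_subset hu))).differentiableAt.differentiableWithinAt) ?_
    intro u hu
    rw [(ha u (hDX (interior_subset hu))).deriv]
    exact hnn u (interior_subset hu)
  set S : Set ℝ := {y | y ≤ x ∧ a y = 0} with hS
  by_cases hSne : S.Nonempty
  · -- Case B: there is a zero to the left; `z` = the last one
    have hbdd : BddAbove S := ⟨x, fun y hy => hy.1⟩
    set z := sSup S with hz
    have hzx : z ≤ x := csSup_le hSne fun y hy => hy.1
    have hzX : z < X := lt_of_le_of_lt hzx hx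
    have haz : a z = 0 := by
      by_contra hne
      have hev : ∀ᶠ y in 𝓝 z, a y ≠ 0 := (hcont z hzX).eventually_ne hne
      obtain ⟨δ, hδ, hball⟩ := Metric.eventually_nhds_iff.mp hev
      have : z ≤ z - δ := by
        refine csSup_le hSne fun y hy => ?_
        by_contra hlt
        push Not at hlt
        have hyz : y ≤ z := le_csSup hbdd hy
        have : dist y z < δ := by
          rw [Real.dist_eq, abs_sub_comm, abs_of_nonneg (by linarith)]
          linarith
        exact hball this hy.2
      linarith
    have hzx' : z < x := lt_of_le_of_ne hzx (fun h => by rw [h] at haz; linarith)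
    -- `a = 0` on `(-∞, z]`
    have hzero : ∀ y ≤ z, a y = 0 := by
      intro y hy
      have h := hmono2 (Set.mem_Iio.mpr (lt_of_le_of_lt hy hzX)) (Set.mem_Iio.mpr hzX) hy
      simp only [haz] at h
      nlinarith [sq_nonneg (a y)]
    -- `a' z = 0`
    have haz' : a' z = 0 := by
      have h1 : HasDerivWithinAt a (a' z) (Iic z) z := (ha z hzX).hasDerivWithinAt
      have h2 : HasDerivWithinAt a 0 (Iic z) z :=
        (hasDerivWithinAt_const z (Iic z) (0 : ℝ)).congr (fun y hy => hzero y hy) (hzero z le_rfl)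
      exact (uniqueDiffWithinAt_Iic z).eq_deriv _ h1 h2
    -- `a > 0` on `(z, x]`, `a ≥ 0` on `[z, x]`
    have hne : ∀ u ∈ Ioc z x, a u ≠ 0 := by
      intro u hu h0
      have : u ≤ z := le_csSup hbdd ⟨hu.2, h0⟩
      linarith [hu.1]
    have hpos : ∀ u ∈ Ioc z x, 0 < a u := by
      intro u hu
      exact hposI u hu.2 (fun v hv => hne v ⟨lt_of_lt_of_le hu.1 hv.1, hv.2⟩) u ⟨le_rfl, hu.2⟩
    have hnn : ∀ u ∈ Icc z x, 0 ≤ a u := by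
      intro u hu
      rcases eq_or_lt_of_le hu.1 with h | h
      · rw [← h, haz]
      · exact (hpos u ⟨h, hu.2⟩).le
    have hDX : Icc z x ⊆ Iio X := fun u hu => lt_of_le_of_lt hu.2 hx
    have hd'mono := hderivmono (Icc z x) (convex_Icc z x) hDX hnn
    have hd'nn : ∀ u ∈ Icc z x, 0 ≤ a' u := fun u hu => by
      have := hd'mono (left_mem_Icc.mpr hzx) hu hu.1
      rwa [haz'] at this
    have hamono' := hamono (Icc z x) (convex_Icc z x) hDX hd'nn
    -- the bound `a' ≤ Φ a` on `[z, x]`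
    have hbound : ∀ s ∈ Icc z x, a' s ≤ C / κ * Real.exp (κ * s) * a s := by
      intro s hs
      have hsX : s < X := hDX hs
      have h1 := deriv_sub_eq_integral hVc ha ha' hs.1 hsX
      rw [haz', sub_zero] at h1
      rw [h1]
      refine integral_mul_le hVc hV0 hC hκ hVexp ha hs.1 hsX (fun u hu => ?_) (hnn s hs)
      exact hamono' ⟨hu.1, hu.2.trans hs.2⟩ hs hu.2
    have key := nonpos_of_bound (convex_Icc z x) hDX (right_mem_Icc.mpr hzx) hC hκ ha hbound
      (fun ε hε => ⟨z, left_mem_Icc.mpr hzx, hzx, by rw [haz], by rw [haz]; exact hε⟩)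
    linarith
  · -- Case A: `a ≠ 0`, hence `a > 0`, on `(-∞, x]`
    have hne : ∀ u ≤ x, a u ≠ 0 := by
      intro u hu h0
      exact hSne ⟨u, hu, h0⟩
    have hpos : ∀ u ≤ x, 0 < a u := fun u hu =>
      hposI u hu (fun v hv => hne v hv.2) u ⟨le_rfl, hu⟩
    have hDX : Iic x ⊆ Iio X := fun u hu => lt_of_le_of_lt (Set.mem_Iic.mp hu) hx
    have hd'mono := hderivmono (Iic x) (convex_Iic x) hDX (fun u hu => (hpos u hu).le)
    -- `a` is bounded by `a x` on `(-∞, x]` (monotone square)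
    have hbdd : ∀ u ≤ x, a u ≤ a x := by
      intro u hu
      have h := hmono2 (Set.mem_Iio.mpr (hDX hu)) (Set.mem_Iio.mpr hx) hu
      exact (pow_le_pow_iff_left₀ (hpos u hu).le (hpos x le_rfl).le two_ne_zero).mp h
    -- `a' ≥ 0` on `(-∞, x]`
    have hd'nn : ∀ u ∈ Iic x, 0 ≤ a' u := by
      intro y₀ hy₀
      have hy₀x : y₀ ≤ x := hy₀
      by_contra hneg
      push Not at hneg
      set δ' : ℝ := -a' y₀ with hδ'
      have hδ'pos : 0 < δ' := by rw [hδ']; linarith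
      have hgrow : ∀ y ≤ y₀, a y₀ + δ' * (y₀ - y) ≤ a y := by
        intro y hy
        have key := (convex_Iic y₀).image_sub_le_mul_sub_of_deriv_le (f := a)
          (fun u hu => (ha u (hDX (le_trans (Set.mem_Iic.mp hu) hy₀x))).continuousAt.continuousWithinAt)
          (by
            rw [interior_Iic]
            exact fun u hu => (ha u (hDX (le_trans (le_of_lt (Set.mem_Iio.mp hu)) hy₀x))).differentiableAt.differentiableWithinAt)
          (C := -δ')
          (by
            rw [interior_Iic]
            intro u hu
            have hu' : u < y₀ := Set.mem_Iio.mp hu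
            rw [(ha u (hDX (le_trans hu'.le hy₀x))).deriv, hδ', neg_neg]
            exact hd'mono (show u ∈ Iic x from le_trans hu'.le hy₀x) hy₀ hu'.le)
          y hy y₀ Set.self_mem_Iic hy
        linarith
      set y : ℝ := y₀ - (a x + 1) / δ' with hy
      have hq : 0 < (a x + 1) / δ' := div_pos (by linarith [hpos x le_rfl]) hδ'pos
      have hyle : y ≤ y₀ := by rw [hy]; linarith
      have h1 := hgrow y hyle
      have h2 : δ' * (y₀ - y) = a x + 1 := by
        rw [hy]
        field_simp
        ring
      have h3 := hbdd y (hyle.trans hy₀x)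
      have h4 := hpos y₀ hy₀x
      linarith
    have hamono' := hamono (Iic x) (convex_Iic x) hDX hd'nn
    -- `inf a' = 0` to the left of every point
    have hinf : ∀ s ≤ x, ∀ ε > 0, ∃ y < s, a' y < ε := by
      intro s hs ε hε
      by_contra h
      push Not at h
      have hgrow : ∀ y ≤ s, ε * (s - y) ≤ a s - a y := by
        intro y hy
        exact (convex_Iic s).mul_sub_le_image_sub_of_le_deriv (f := a)
          (fun u hu => (ha u (hDX (le_trans (Set.mem_Iic.mp hu) hs))).continuousAt.continuousWithinAt)
          (by
            rw [interior_Iic]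
            exact fun u hu => (ha u (hDX (le_trans (le_of_lt (Set.mem_Iio.mp hu)) hs))).differentiableAt.differentiableWithinAt)
          (C := ε)
          (by
            rw [interior_Iic]
            intro u hu
            have hu' : u < s := Set.mem_Iio.mp hu
            rw [(ha u (hDX (le_trans hu'.le hs))).deriv]
            exact h u hu')
          y hy s Set.self_mem_Iic hy
      set y : ℝ := s - (a s + 1) / ε with hy
      have hq : 0 < (a s + 1) / ε := div_pos (by linarith [hpos s hs]) hε
      have hyle : y ≤ s := by rw [hy]; linarith
      have h1 := hgrow y hyle
      have h2 : ε * (s - y) = a s + 1 := by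
        rw [hy]
        field_simp
        ring
      have h3 := hpos y (hyle.trans hs)
      linarith
    -- the bound `a' ≤ Φ a` on `(-∞, x]`
    have hbound : ∀ s ∈ Iic x, a' s ≤ C / κ * Real.exp (κ * s) * a s := by
      intro s hs
      have hsx : s ≤ x := hs
      have hsX : s < X := hDX hs
      refine le_of_forall_pos_lt_add fun ε hε => ?_
      obtain ⟨y, hys, hy⟩ := hinf s hsx ε hε
      have h1 := deriv_sub_eq_integral hVc ha ha' hys.le hsX
      have h2 := integral_mul_le hVc hV0 hC hκ hVexp ha hys.le hsX
        (fun u hu => hamono' (show u ∈ Iic x from le_trans hu.2 hsx) hs hu.2) (hpos s hsx).le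
      linarith
    have hsmall : ∀ ε > 0, ∃ y ∈ Iic x, y ≤ x ∧ 0 ≤ a y ∧ a y < ε := by
      intro ε hε
      obtain ⟨y₁, hy₁X, hy₁⟩ := sq_eventually_le hV0 ha ha' hint (pow_pos hε 2)
      refine ⟨min x y₁, min_le_left x y₁, min_le_left x y₁, (hpos _ (min_le_left x y₁)).le, ?_⟩
      have h := hy₁ (min x y₁) (min_le_right x y₁)
      exact (pow_lt_pow_iff_left₀ (hpos _ (min_le_left x y₁)).le hε.le two_ne_zero).mp h
    have key := nonpos_of_bound (convex_Iic x) hDX Set.self_mem_Iic hC hκ ha hbound hsmall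
    linarith

/-- **Decay lemma.**  If `a'' = V a` on `(−∞, X)` with `V ≥ 0` continuous, `V(x) ≤ C e^{κx}`
(`κ > 0`, `C ≥ 0`), and `a² ∈ L¹(−∞, X)`, then `a ≡ 0` on `(−∞, X)`. [folklore] -/
theorem eq_zero_of_sq_integrableOn (hκ : 0 < κ) (hC : 0 ≤ C) (hVc : Continuous V)
    (hV0 : ∀ x, 0 ≤ V x) (hVexp : ∀ x < X, V x ≤ C * Real.exp (κ * x))
    (ha : ∀ x < X, HasDerivAt a (a' x) x) (ha' : ∀ x < X, HasDerivAt a' (V x * a x) x)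
    (hint : IntegrableOn (fun x => a x ^ 2) (Iio X)) : ∀ x < X, a x = 0 := by
  intro x hx
  rcases lt_trichotomy (a x) 0 with h | h | h
  · have hna : ∀ y < X, HasDerivAt (fun y => -a y) (-a' y) y := fun y hy => (ha y hy).neg
    have hna' : ∀ y < X, HasDerivAt (fun y => -a' y) (V y * -a y) y := fun y hy =>
      ((ha' y hy).neg).congr_deriv (by ring)
    have hint' : IntegrableOn (fun y => (-a y) ^ 2) (Iio X) := by
      simpa only [neg_sq] using hint
    have := not_pos (a := fun y => -a y) (a' := fun y => -a' y) hκ hC hVc hV0 hVexp hna hna'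
      hint' hx
    exact absurd (by simpa using h) this
  · exact h
  · exact absurd h (not_pos hκ hC hVc hV0 hVexp ha ha' hint hx)

end KernelDecay

end

end Summit.FinalStateConjecture.FinalStateConjecture.Theorems
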